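import Literature.MathematicalPhysics.QuantumManyBody.PeriodicCondensateCoherence
import Literature.MathematicalPhysics.QuantumManyBody.PeriodicBoseGasEq317
import Literature.MathematicalPhysics.QuantumManyBody.PeriodicBoseGasThm31
import Literature.MathematicalPhysics.QuantumManyBody.SwapPurity

/-!
# Route `BECSwapNoCatastrophe` — support item `SwapToZeroMode` (stmt-AtomisticToContinuum-14397):
the translation average of the occupation of a mode is bounded by the zero-mode occupation

Helper file for `Summit.AtomisticToContinuum.BoseEinsteinCondensation.Theses.BECSwapNoCatastrophe.SwapToZeroMode`
(step (3) of the planner's sketch, Fourier-free form). For a REAL NON-NEGATIVE periodic state `Φ` of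
`n+1` bosons on the torus of side `L` and any one-body mode `u` with `∫ |u|² ≤ 1`,

  `∫_{[0,L)³} occ(u, 1_{cell^N} τ₋ₛΦ) ds ≤ L³ ⟨Φ, n₀ Φ⟩`,

where `τ₋ₛΦ(X) = Φ(X + s𝟙)` is the state with all bosons moved by `-s` and
`occ = Literature.MathematicalPhysics.QuantumManyBody.BoseGas.occupation`: the translation AVERAGE of
the occupations of `u` in the translates of `Φ` is at most the constant-mode occupation of `Φ`
(for `Φ ≥ 0` the translation-averaged one-particle density matrix is convolution by a non-negative
function, whose top eigenvalue is its integral, attained on the constant). Proof without Fourier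
series: `|∫ ū Φ(·+s, Y')| ≤ ∫ |u| Φ(·+s, Y')`, Cauchy–Schwarz with the weight `Φ(·+s, Y') ≥ 0`,
Tonelli, and the shift invariance of cell integrals of periodic functions
(`setLIntegral_cell_comp_add_of_periodic`, `lintegral_cellN_comp_add`), ending in
`N L⁻³ ∫ (∫_cell Φ(x,Y) dx)² dY = ⟨Φ, n₀Φ⟩` (`condensateOccupation_succ`).
-/

noncomputable section

namespace Summit.AtomisticToContinuum.BoseEinsteinCondensation.Theorems

open MeasureTheory
open scoped ENNReal NNReal ComplexConjugate
open Literature.MathematicalPhysics.QuantumManyBody.BoseGas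

namespace SwapToZeroMode

variable {n : ℕ} {L : ℝ}

/-- `(x :: Y) + s𝟙 = (x + s) :: (Y + s𝟙)`: moving all `n+1` bosons by `s`. [folklore] -/
theorem vecCons_add_const (x s : Space) (Y : Config n) :
    (Matrix.vecCons x Y : Config (n + 1)) + (fun _ => s) = Matrix.vecCons (x + s) (Y + fun _ => s) := by
  funext j
  refine Fin.cases ?_ (fun k => ?_) j
  · simp
  · simp

/-- `x :: (Y + eᵢ ⊗ e) = (x :: Y) + e_{i+1} ⊗ e`. [folklore] -/
theorem vecCons_add_single_right (x : Space) (Y : Config n) (i : Fin n) (e : Space) :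
    (Matrix.vecCons x (Y + Pi.single i e) : Config (n + 1)) =
      Matrix.vecCons x Y + Pi.single i.succ e := by
  funext j
  refine Fin.cases ?_ (fun k => ?_) j
  · simp
  · by_cases hk : k = i
    · subst hk; simp
    · have hks : k.succ ≠ i.succ := fun h => hk (Fin.succ_inj.1 h)
      simp [hk, hks]

/-- **Occupations of a mode in a cell-indicator state**: for `Θ` on `(ℝ³)^{n+1}` and a mode `u`,
`occ(u, 1_{cell^{n+1}} Θ) = (n+1) ∫_{cell^n} |∫_cell conj(u x) Θ(x, Y) dx|² dY` (all integrals
restricted to the fundamental cell). [cite: LSSY2005, §1.2 (1.17)] -/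
theorem occupation_indicator_cellN (L : ℝ) (u : Space → ℂ) (Θ : Config (n + 1) → ℂ) :
    occupation (n + 1) u ((cellN (n + 1) L).indicator Θ) =
      (n + 1 : ℝ≥0∞) * ∫⁻ Y in cellN n L,
        (‖∫ x in cell L, conj (u x) * Θ (Matrix.vecCons x Y)‖₊ : ℝ≥0∞) ^ 2 := by
  have hpt : ∀ Y : Config n,
      (‖∫ x, conj (u x) * (cellN (n + 1) L).indicator Θ (Matrix.vecCons x Y)‖₊ : ℝ≥0∞) ^ 2 =
        (cellN n L).indicator (fun Y =>
          (‖∫ x in cell L, conj (u x) * Θ (Matrix.vecCons x Y)‖₊ : ℝ≥0∞) ^ 2) Y := by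
    intro Y
    by_cases hY : Y ∈ cellN n L
    · rw [Set.indicator_of_mem hY]
      have hint : (fun x => conj (u x) * (cellN (n + 1) L).indicator Θ (Matrix.vecCons x Y)) =
          (cell L).indicator (fun x => conj (u x) * Θ (Matrix.vecCons x Y)) := by
        funext x
        by_cases hx : x ∈ cell L
        · have hmem : Matrix.vecCons x Y ∈ cellN (n + 1) L := by
            intro j
            refine Fin.cases ?_ (fun k => ?_) j
            · simpa using hx
            · simpa using hY k
          simp [hx, hmem, Set.indicator_of_mem]
        · have hmem : Matrix.vecCons x Y ∉ cellN (n + 1) L := fun h => hx (by simpa using h 0)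
          simp [hx, hmem]
      rw [hint, integral_indicator (measurableSet_cell L)]
    · rw [Set.indicator_of_notMem hY]
      have hint : (fun x => conj (u x) * (cellN (n + 1) L).indicator Θ (Matrix.vecCons x Y)) =
          fun _ => 0 := by
        funext x
        have hmem : Matrix.vecCons x Y ∉ cellN (n + 1) L := by
          intro h
          exact hY fun k => by simpa using h k.succ
        simp [hmem]
      rw [hint]
      simp
  show (n + 1 : ℝ≥0∞) * ∫⁻ Y, _ = _
  congr 1
  simp only [hpt]
  rw [lintegral_indicator (measurableSet_cellN n L)]

/-- **The translation average of the occupations of a mode is bounded by the zero-mode occupation**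
(real non-negative periodic states). For `Φ ≥ 0` a periodic trial state of `n+1` bosons on the torus of
side `L > 0` and a measurable mode `u` with `∫ |u|² ≤ 1`:
`∫_{[0,L)³} occ(u, 1_{cell^{n+1}} Φ(· + s𝟙)) ds ≤ L³ ⟨Φ, n₀Φ⟩`. Mechanism: for each bath configuration
`Y`, `|∫_cell ū(x) Φ(x+s, Y) dx|² ≤ (∫_cell |u|² Φ(·+s, Y)) (∫_cell Φ(·, Y))` (Cauchy–Schwarz with the
non-negative weight `Φ`), and `∫_cell Φ(x+s, Y) ds = ∫_cell Φ(·, Y)` (torus shift), so the `s`-average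
is at most `∫ |u|² · N L⁻³ ∫_{cell^n} (∫_cell Φ(x, Y) dx)² dY = ⟨Φ, n₀Φ⟩`.
[cite: PenroseOnsager1956, §4 (5)–(7)] -/
theorem lintegral_occupation_translate_le (hL : 0 < L) (Φ : PeriodicTrialState (n + 1) L)
    (hreal : ∀ X, Φ.ψ X = (‖Φ.ψ X‖ : ℂ)) {u : Space → ℂ} (hu : Measurable u)
    (hu1 : ∫⁻ x, (‖u x‖₊ : ℝ≥0∞) ^ 2 ≤ 1) :
    ∫⁻ s in cell L, occupation (n + 1) u
        ((cellN (n + 1) L).indicator fun X => Φ.ψ (X + fun _ => s)) ≤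
      ENNReal.ofReal L ^ 3 * condensateOccupation (n + 1) L Φ.ψ := by
  have hL3 : ENNReal.ofReal L ^ 3 ≠ 0 := pow_ne_zero _ (by simpa using hL)
  have hL3' : ENNReal.ofReal L ^ 3 ≠ ⊤ := ENNReal.pow_ne_top ENNReal.ofReal_ne_top
  -- notation: `A = |u|²`, `P x Y = |Φ(x :: Y)|`, `S Y = ∫_cell P(·, Y)`
  set A : Space → ℝ≥0∞ := fun x => (‖u x‖₊ : ℝ≥0∞) ^ 2 with hA
  set P : Space → Config n → ℝ≥0∞ := fun x Y => (‖Φ.ψ (Matrix.vecCons x Y)‖₊ : ℝ≥0∞) with hP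
  set S : Config n → ℝ≥0∞ := fun Y => ∫⁻ x in cell L, P x Y with hS
  -- measurability
  have hAm : Measurable A := hu.nnnorm.coe_nnreal_ennreal.pow_const 2
  have hPc : Continuous fun p : Space × Config n => P p.1 p.2 :=
    ENNReal.continuous_coe.comp
      ((Φ.contDiff.continuous.comp (continuous_fst.matrixVecCons continuous_snd)).nnnorm)
  have hPY : ∀ Y, Measurable fun x => P x Y := fun Y =>
    (hPc.comp (Continuous.prodMk continuous_id continuous_const)).measurable
  have hSm : Measurable S := by
    refine Measurable.lintegral_prod_right' (f := fun z : Config n × Space => P z.2 z.1) ?_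
    exact (hPc.comp (by fun_prop : Continuous fun z : Config n × Space => (z.2, z.1))).measurable
  -- periodicity
  have hPper_x : ∀ (Y : Config n) (x : Space) (k : Fin 3),
      P (x + EuclideanSpace.single k L) Y = P x Y := by
    intro Y x k
    simp only [hP, Φ.vecCons_add_axis_left]
  have hPper_Y : ∀ (x : Space) (Y : Config n) (i : Fin n) (k : Fin 3),
      P x (Y + Pi.single i (EuclideanSpace.single k L)) = P x Y := by
    intro x Y i k
    simp only [hP, vecCons_add_single_right, Φ.periodic]
  have hSper : ∀ (Y : Config n) (i : Fin n) (k : Fin 3),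
      S (Y + Pi.single i (EuclideanSpace.single k L)) = S Y := by
    intro Y i k
    simp only [hS, hPper_Y]
  -- shift of the cell in the tagged coordinate
  have hshift_x : ∀ (Y : Config n) (a : Space), ∫⁻ x in cell L, P (x + a) Y = S Y := fun Y a =>
    setLIntegral_cell_comp_add_of_periodic hL (hPY Y) (hPper_x Y) a
  -- pointwise bound (Cauchy–Schwarz with the weight `Φ ≥ 0`)
  have hpt : ∀ (s : Space) (Y : Config n),
      (‖∫ x in cell L, conj (u x) * Φ.ψ (Matrix.vecCons x Y + fun _ => s)‖₊ : ℝ≥0∞) ^ 2 ≤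
        S (Y + fun _ => s) * ∫⁻ x in cell L, A x * P (x + s) (Y + fun _ => s) := by
    intro s Y
    set Y' : Config n := Y + fun _ => s with hY'
    have hPm : Measurable fun x => P (x + s) Y' := (hPY Y').comp (measurable_id.add_const s)
    have h1 : (‖∫ x in cell L, conj (u x) * Φ.ψ (Matrix.vecCons x Y + fun _ => s)‖₊ : ℝ≥0∞) ≤
        ∫⁻ x in cell L, (‖u x‖₊ : ℝ≥0∞) * P (x + s) Y' := by
      calc (‖∫ x in cell L, conj (u x) * Φ.ψ (Matrix.vecCons x Y + fun _ => s)‖₊ : ℝ≥0∞)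
          ≤ ∫⁻ x in cell L, ‖conj (u x) * Φ.ψ (Matrix.vecCons x Y + fun _ => s)‖ₑ :=
            enorm_integral_le_lintegral_enorm _
        _ = ∫⁻ x in cell L, (‖u x‖₊ : ℝ≥0∞) * P (x + s) Y' := lintegral_congr fun x => by
            rw [enorm_mul, ← ofReal_norm (conj (u x)), Complex.norm_conj, ofReal_norm,
              vecCons_add_const, enorm_eq_nnnorm, enorm_eq_nnnorm]
    have h2 : (∫⁻ x in cell L, (‖u x‖₊ : ℝ≥0∞) * P (x + s) Y') ^ 2 ≤
        (∫⁻ x in cell L, A x * P (x + s) Y') * ∫⁻ x in cell L, P (x + s) Y' := by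
      have hsq : ∀ y : ℝ≥0∞, (y ^ (1 / 2 : ℝ)) ^ 2 = y := fun y => by
        rw [← ENNReal.rpow_two, ← ENNReal.rpow_mul]
        norm_num
      have hf : AEMeasurable (fun x => (‖u x‖₊ : ℝ≥0∞) * P (x + s) Y' ^ (1 / 2 : ℝ))
          (volume.restrict (cell L)) :=
        (hu.nnnorm.coe_nnreal_ennreal.mul (hPm.pow_const _)).aemeasurable
      have hg : AEMeasurable (fun x => P (x + s) Y' ^ (1 / 2 : ℝ)) (volume.restrict (cell L)) :=
        (hPm.pow_const _).aemeasurable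
      have h := lintegral_mul_sq_le (volume.restrict (cell L)) hf hg
      have e1 : ∀ x, (‖u x‖₊ : ℝ≥0∞) * P (x + s) Y' ^ (1 / 2 : ℝ) * P (x + s) Y' ^ (1 / 2 : ℝ) =
          (‖u x‖₊ : ℝ≥0∞) * P (x + s) Y' := fun x => by
        rw [mul_assoc, ← sq, hsq]
      have e2 : ∀ x, ((‖u x‖₊ : ℝ≥0∞) * P (x + s) Y' ^ (1 / 2 : ℝ)) ^ 2 = A x * P (x + s) Y' :=
        fun x => by rw [mul_pow, hsq]
      have e3 : ∀ x, (P (x + s) Y' ^ (1 / 2 : ℝ)) ^ 2 = P (x + s) Y' := fun x => hsq _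
      simp only [e1, e2, e3] at h
      exact h
    calc (‖∫ x in cell L, conj (u x) * Φ.ψ (Matrix.vecCons x Y + fun _ => s)‖₊ : ℝ≥0∞) ^ 2
        ≤ (∫⁻ x in cell L, (‖u x‖₊ : ℝ≥0∞) * P (x + s) Y') ^ 2 := by gcongr
      _ ≤ (∫⁻ x in cell L, A x * P (x + s) Y') * ∫⁻ x in cell L, P (x + s) Y' := h2
      _ = (∫⁻ x in cell L, A x * P (x + s) Y') * S Y' := by rw [hshift_x]
      _ = S Y' * ∫⁻ x in cell L, A x * P (x + s) Y' := mul_comm _ _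
  -- Step 1: the occupation of `u` in a translate, shifted back to the cell in `Y`
  have step1 : ∀ s : Space, occupation (n + 1) u
      ((cellN (n + 1) L).indicator fun X => Φ.ψ (X + fun _ => s)) ≤
        (n + 1 : ℝ≥0∞) * ∫⁻ Y in cellN n L, S Y * ∫⁻ x in cell L, A x * P (x + s) Y := by
    intro s
    rw [occupation_indicator_cellN]
    set G : Config n → ℝ≥0∞ := fun Y => S Y * ∫⁻ x in cell L, A x * P (x + s) Y with hG
    have hGper : ∀ (Y : Config n) (i : Fin n) (k : Fin 3),
        G (Y + Pi.single i (EuclideanSpace.single k L)) = G Y := by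
      intro Y i k
      simp only [hG, hSper, hPper_Y]
    gcongr ?_ * ?_
    · exact le_rfl
    calc ∫⁻ Y in cellN n L,
          (‖∫ x in cell L, conj (u x) * Φ.ψ (Matrix.vecCons x Y + fun _ => s)‖₊ : ℝ≥0∞) ^ 2
        ≤ ∫⁻ Y in cellN n L, G (Y + fun _ => s) := lintegral_mono fun Y => hpt s Y
      _ = ∫⁻ Y in cellN n L, G Y := lintegral_cellN_comp_add hL hGper _
  -- Step 2: integrate over the translation `s` (Tonelli and the torus shift in `s`)
  have hF : Measurable fun p : Space × Config n => ∫⁻ x in cell L, A x * P (x + p.1) p.2 := by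
    refine Measurable.lintegral_prod_right'
      (f := fun z : (Space × Config n) × Space => A z.2 * P (z.2 + z.1.1) z.1.2) ?_
    exact (hAm.comp measurable_snd).mul
      (hPc.comp (by fun_prop : Continuous fun z : (Space × Config n) × Space =>
        (z.2 + z.1.1, z.1.2))).measurable
  have hFY : ∀ Y : Config n, Measurable fun s : Space => ∫⁻ x in cell L, A x * P (x + s) Y := by
    intro Y
    refine Measurable.lintegral_prod_right'
      (f := fun z : Space × Space => A z.2 * P (z.2 + z.1) Y) ?_
    exact (hAm.comp measurable_snd).mul
      ((hPY Y).comp (measurable_snd.add measurable_fst))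
  have step2 : ∫⁻ s in cell L, ∫⁻ Y in cellN n L, S Y * ∫⁻ x in cell L, A x * P (x + s) Y ≤
      ∫⁻ Y in cellN n L, S Y ^ 2 := by
    rw [lintegral_lintegral_swap (((hSm.comp measurable_snd).mul hF).aemeasurable)]
    refine lintegral_mono fun Y => ?_
    rw [lintegral_const_mul _ (hFY Y), sq]
    gcongr
    have hswap : ∫⁻ s in cell L, ∫⁻ x in cell L, A x * P (x + s) Y =
        ∫⁻ x in cell L, ∫⁻ s in cell L, A x * P (x + s) Y := by
      refine lintegral_lintegral_swap ?_
      exact ((hAm.comp measurable_snd).mul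
        ((hPY Y).comp (measurable_snd.add measurable_fst))).aemeasurable
    rw [hswap]
    calc ∫⁻ x in cell L, ∫⁻ s in cell L, A x * P (x + s) Y = ∫⁻ x in cell L, A x * S Y :=
          lintegral_congr fun x => by
            rw [lintegral_const_mul (A x) (f := fun s => P (x + s) Y)
              ((hPY Y).comp (measurable_id.const_add x))]
            congr 1
            have h : (fun s => P (x + s) Y) = fun s => P (s + x) Y := funext fun s => by
              rw [add_comm]
            rw [h]
            exact hshift_x Y x
      _ = (∫⁻ x in cell L, A x) * S Y := lintegral_mul_const _ hAm
      _ ≤ 1 * S Y := by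
          gcongr
          exact (setLIntegral_le_lintegral _ _).trans hu1
      _ = S Y := one_mul _
  -- Step 3: the right-hand side through slices
  have hrhs : ENNReal.ofReal L ^ 3 * condensateOccupation (n + 1) L Φ.ψ =
      (n + 1 : ℝ≥0∞) * ∫⁻ Y in cellN n L, S Y ^ 2 := by
    rw [condensateOccupation_succ hL]
    simp_rw [enorm_integral_slice_eq Φ hreal]
    rw [← mul_assoc, mul_comm (ENNReal.ofReal L ^ 3), mul_assoc, ← mul_assoc (ENNReal.ofReal L ^ 3),
      ENNReal.mul_inv_cancel hL3 hL3', one_mul]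
  -- assemble
  calc ∫⁻ s in cell L, occupation (n + 1) u
          ((cellN (n + 1) L).indicator fun X => Φ.ψ (X + fun _ => s))
      ≤ ∫⁻ s in cell L, (n + 1 : ℝ≥0∞) *
          ∫⁻ Y in cellN n L, S Y * ∫⁻ x in cell L, A x * P (x + s) Y := lintegral_mono step1
    _ = (n + 1 : ℝ≥0∞) *
          ∫⁻ s in cell L, ∫⁻ Y in cellN n L, S Y * ∫⁻ x in cell L, A x * P (x + s) Y :=
        lintegral_const_mul' _ _ (by simp)
    _ ≤ (n + 1 : ℝ≥0∞) * ∫⁻ Y in cellN n L, S Y ^ 2 := by gcongr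
    _ = ENNReal.ofReal L ^ 3 * condensateOccupation (n + 1) L Φ.ψ := hrhs.symm

end SwapToZeroMode

end Summit.AtomisticToContinuum.BoseEinsteinCondensation.Theorems

end
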